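import Literature.NumberTheory.EllipticCurves.ComplexMultiplicationBSDTripleCasselsProofs
import Literature.NumberTheory.EllipticCurves.ComplexMultiplicationLFunctionTableProofs
import HarnessLib

/-!
# bsd.S28 (geometric-CM form): the sharpest assembly — Corollary 2, the `only if` half of the CM
classification, and Cassels' quotient form

Third sibling proof file of `Literature.NumberTheory.EllipticCurves.ComplexMultiplication` for the
named fact `Literature.NumberTheory.EllipticCurves.bsdTriple_of_hasCM_of_L_one_ne_zero` (**bsd.S28**,
full Birch–Swinnerton-Dyer statement for a globally minimal `W/ℚ` with geometric complex
multiplication and `L(E,1) ≠ 0`; Burungale–Flach, *Camb. J. Math.* 12 (2024), Cor. 2 and the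
sentence following it, arXiv:2206.09874 p. 4), after `ComplexMultiplicationBSDTripleProofs.lean`
(reduction to four printed leaves) and `ComplexMultiplicationBSDTripleCasselsProofs.lean` (the
isogeny step through Cassels' quotient form `WeierstrassCurve.bsdRHS_eq_of_isIsogenous`, leaves:
Cor. 2 as printed, Silverman *AT* Ex. 2.12(b), Knapp 11.67, Cassels). Two of those four leaves are
removed here, using material the tree proves elsewhere:

* **Knapp's Thm. 11.67 is not needed in general.** The tree *proves* that every CM elliptic curve
  over `ℚ` is `ℚ`-isogenous to one with maximal-order `j` **and the same formal `L`-function**,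
  granted only the `only if` half `Literature.NumberTheory.EllipticCurves.j_mem_cmJInvariants_of_hasCM`
  of the CM classification (`HasCM E → j(E)` is one of the thirteen class-number-one values;
  Silverman *AEC* C.11.3.1–3.2, Heegner–Baker–Stark):
  `Literature.NumberTheory.EllipticCurves.exists_isIsogenous_LFunction_eq_of_hasCM_of_j_mem_cmJInvariants_of_hasCM`
  (`ComplexMultiplicationLFunctionTableProofs.lean` — the four explicit isogeny classes `36a`,
  `32a`, `27a`, `49a` and all their quadratic twists, Knapp's theorem verified prime by prime for
  them in `ComplexMultiplicationLocalFactors12/16/27/28.lean`). The target may be taken globally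
  minimal with the same `L`-series (`exists_isGloballyMinimal_isIsogenous_LSeries_eq_of_hasCM`: the
  discharged `WeierstrassCurve.hasGlobalMinimalModel_rat_holds`, `IsIsogenous.smul_right`,
  `variableChange_j` and the proved isomorphism invariance `WeierstrassCurve.LSeries_smul`), and the
  descent of BSD along the isogeny needs only equal `L`-series
  (`WeierstrassCurve.bsdTriple_of_isIsogenous_of_finite_point_of_LSeries_eq`). This also removes
  Silverman's Ex. 2.12(b) (`exists_isIsogenous_j_mem_maximalCMJInvariants_of_hasCM`), which
  `ComplexMultiplicationMaximalOrderProofs.lean` had reduced to the same `h₁` anyway.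
* Hence **the sharpest assembly**
  `Literature.NumberTheory.EllipticCurves.bsdTriple_of_hasCM_of_L_one_ne_zero_of_BurungaleFlach2024_of_j_mem_cmJInvariants_of_hasCM`:
  bsd.S28 (geometric-CM form) from Corollary 2 over `ℚ` as printed
  (`Literature.NumberTheory.EllipticCurves.BurungaleFlach2024_bsd_rat`), `j_mem_cmJInvariants_of_hasCM`
  and `bsdRHS_eq_of_isIsogenous` — and its level-2 composition with the Burungale–Flach chain.
  The trust base of the geometric-CM form is therefore that of the verbatim form
  `bsdTriple_of_j_mem_maximalCMJInvariants_of_L_one_ne_zero` plus `j_mem_cmJInvariants_of_hasCM`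
  plus (below level 3, where it is not already a leaf) `bsdRHS_eq_of_isIsogenous`.
The discharge `bsdTriple_of_hasCM_of_L_one_ne_zero_holds` is *not* asserted: it is
`bsdTriple_of_hasCM_of_L_one_ne_zero_of_BurungaleFlach2024_of_j_mem_cmJInvariants_of_hasCM hBF h₁ hISO`
for proofs of Burungale–Flach's Corollary 2, of `j_mem_cmJInvariants_of_hasCM` and of Cassels'
theorem, none of which Mathlib (v4.32.0) can presently supply.

## Design notes

* Pure theorems, no new `def` (kernel-reviewed); nothing restated: the table-with-`L`-functions,
  `LSeries_smul`, the global minimal model, the quotient fact and the level-1/2 assemblies are all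
  imported.
* Group rules of the topic: `noncomputable section`, `open scoped Classical`; curve-level descent
  lemmas are deliberate dot-notation extensions in `namespace WeierstrassCurve`, the bsd.S28
  assemblies live in `namespace Literature.NumberTheory.EllipticCurves` next to the fact.

## References

* A. Burungale, M. Flach, *The conjecture of Birch and Swinnerton-Dyer for certain elliptic curves
  with complex multiplication*, Camb. J. Math. 12 (2024), Cor. 2 and the sentence following its
  proof (arXiv:2206.09874, p. 4). [BurungaleFlach2024]
* J. W. S. Cassels, *Arithmetic on curves of genus 1. VIII*, J. reine angew. Math. 217 (1965).
  [Cassels1965ArithmeticVIII]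
* J. S. Milne, *Arithmetic Duality Theorems*, 2nd ed. (2006), I.7: Lemma 7.1 (p. 96), Thm. 7.3
  (p. 97), (7.3.1) (p. 98), Notes (p. 101). [MilneADT2006]
* A. W. Knapp, *Elliptic Curves*, Princeton (1992), Thm. 11.67. [Knapp1993]
* J. H. Silverman, *The Arithmetic of Elliptic Curves*, 2nd ed. (2009), III.6.1–6.2, VIII.8.3,
  App. C.11.3.1–3.2. [SilvermanAEC2009]
* J. H. Silverman, *Advanced Topics in the Arithmetic of Elliptic Curves* (1994), II, Ex. 2.12(b);
  App. A §3. [SilvermanAdvancedTopics1994]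
-/

noncomputable section

open scoped Classical

namespace WeierstrassCurve

open Literature.NumberTheory.EllipticCurves

/-! ### Descent along an isogeny with equal `L`-series (no appeal to Knapp 11.67) -/

/-- **BSD descends along a `ℚ`-isogeny with equal `L`-series, in rank zero.** As
`bsdTriple_of_isIsogenous_of_finite_point`, but with the equality `L(W,s) = L(W',s)` of the two
`L`-series as an explicit hypothesis `hLS` in place of Knapp's Thm. 11.67 (for the CM isogenies of
bsd.S28 the tree proves this equality outright, `ComplexMultiplicationLFunctionTableProofs.lean`):
equal `L`-series give equal analytic ranks and leading coefficients
(`analyticRank_eq_of_LSeries_eq`, `leadingLCoeff_eq_of_LSeries_eq`), `E(ℚ)` is finite with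
`E'(ℚ)`, and Cassels' quotient invariance (`hISO`) along the dual isogeny transports `Ш` and the
right-hand side. [cite: MilneADT2006, Thm. I.7.3 (p. 97) with Lemma I.7.1 (p. 96)]
[cite: Cassels1965ArithmeticVIII] -/
theorem bsdTriple_of_isIsogenous_of_finite_point_of_LSeries_eq
    (hISO : bsdRHS_eq_of_isIsogenous)
    {W W' : WeierstrassCurve ℚ} [W.IsElliptic] [W'.IsElliptic] [W.IsGloballyMinimal]
    [W'.IsGloballyMinimal] (hiso : IsIsogenous W W') (hLS : W.LSeries = W'.LSeries)
    (hfin' : Finite W'.toAffine.Point) (h' : W'.BSDTriple) : W.BSDTriple := by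
  obtain ⟨hrank', hsha', hlead'⟩ := h'
  obtain ⟨hsha, hrhs⟩ := hISO W' W hiso.symm_of_charZero hsha'
  have hfin : Finite W.toAffine.Point := finite_point_of_isIsogenous hiso hfin'
  refine ⟨?_, hsha, ?_⟩
  · show W.analyticRank = W.mordellWeilRank
    have hrank'' : W'.analyticRank = W'.mordellWeilRank := hrank'
    -- fully qualified: inside `namespace WeierstrassCurve` the unqualified name now resolves to
    -- the instance-argument form `WeierstrassCurve.mordellWeilRank_eq_zero_of_finite`
    -- (`MordellWeilRankZeroProofs`, transitively imported), shadowing the opened namespace.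
    rw [analyticRank_eq_of_LSeries_eq hLS, hrank'',
      Literature.NumberTheory.EllipticCurves.mordellWeilRank_eq_zero_of_finite W' hfin',
      Literature.NumberTheory.EllipticCurves.mordellWeilRank_eq_zero_of_finite W hfin]
  · show W.leadingLCoeff = (W.bsdRHS : ℂ)
    have hlead'' : W'.leadingLCoeff = (W'.bsdRHS : ℂ) := hlead'
    rw [leadingLCoeff_eq_of_LSeries_eq hLS, hlead'', hrhs]

end WeierstrassCurve

namespace Literature.NumberTheory.EllipticCurves

open WeierstrassCurve

/-! ### bsd.S28 (geometric-CM form) from Corollary 2, the `only if` half of the CM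
classification and Cassels' quotient form — the sharpest assembly -/

/-- **The isogenous maximal-order curve, globally minimal and with the same `L`-series, from the
`only if` half of the classification alone.** Every CM elliptic curve `E/ℚ` is `ℚ`-isogenous to a
*globally minimal* Weierstrass equation of an elliptic curve with `j ∈ maximalCMJInvariants` **and
the same `L`-series**, granted `j_mem_cmJInvariants_of_hasCM` (`h₁`, Silverman *AEC* C.11.3.1–3.2):
the tree's proved table-with-`L`-functions
`exists_isIsogenous_LFunction_eq_of_hasCM_of_j_mem_cmJInvariants_of_hasCM`
(`ComplexMultiplicationLFunctionTableProofs.lean`), a global minimal model of the target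
(`hasGlobalMinimalModel_rat_holds`, Silverman *AEC* VIII.8.3), stability of isogeny under a
change of variables of the target (`IsIsogenous.smul_right`), invariance of `j`
(`variableChange_j`) and of the `L`-series (`LSeries_smul`) under it.
[cite: SilvermanAdvancedTopics1994, Exercise 2.12(b) and App. A §3]
[cite: SilvermanAEC2009, VIII.8, Cor. 8.3] -/
theorem exists_isGloballyMinimal_isIsogenous_LSeries_eq_of_hasCM
    (h₁ : j_mem_cmJInvariants_of_hasCM) (W : WeierstrassCurve ℚ) [W.IsElliptic] (hCM : W.HasCM) :
    ∃ (W' : WeierstrassCurve ℚ) (_ : W'.IsElliptic) (_ : W'.IsGloballyMinimal),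
      IsIsogenous W W' ∧ W'.j ∈ maximalCMJInvariants ∧ W.LSeries = W'.LSeries := by
  obtain ⟨W', hE', hiso, hj', hLF⟩ :=
    exists_isIsogenous_LFunction_eq_of_hasCM_of_j_mem_cmJInvariants_of_hasCM h₁ W hCM
  obtain ⟨C, hC⟩ := hasGlobalMinimalModel_rat_holds W'
  exact ⟨C • W', inferInstance, hC, hiso.smul_right C, by rwa [variableChange_j],
    (LSeries_eq_of_LFunction_eq hLF).trans (LSeries_smul W' C).symm⟩

/-- **bsd.S28 (geometric-CM form) from Corollary 2 over `ℚ` as printed, the `only if` half of the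
CM classification and Cassels' quotient invariance — the sharpest assembly.** The named fact
`bsdTriple_of_hasCM_of_L_one_ne_zero` follows from:
`hBF` — Burungale–Flach, Cor. 2 at `F⁺ = ℚ` with the sentence following it, as printed
(`BurungaleFlach2024_bsd_rat`);
`h₁` — `HasCM E → j(E) ∈ cmJInvariants` (`j_mem_cmJInvariants_of_hasCM`; Silverman *AEC*
C.11.3.1–3.2, Heegner–Baker–Stark);
`hISO` — Cassels' isogeny invariance of the BSD quotient (`WeierstrassCurve.bsdRHS_eq_of_isIsogenous`).
Proof: `exists_isGloballyMinimal_isIsogenous_LSeries_eq_of_hasCM` gives `W ∼ W'`, `W'` globally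
minimal with maximal-order `j` and `L(W',s) = L(W,s)`; so `L(W',1) ≠ 0`, Cor. 2 gives `E'(ℚ)`
finite and (level-1 assembly) `W'.BSDTriple`, which descends to `W` by
`WeierstrassCurve.bsdTriple_of_isIsogenous_of_finite_point_of_LSeries_eq`. Neither Knapp's
Thm. 11.67 in general nor Silverman's Ex. 2.12(b) is used: the four CM isogenies and the equality
of their `L`-functions are proved in the tree.
[cite: BurungaleFlach2024, Cor. 2 and the sentence following its proof (arXiv p. 4)]
[cite: Cassels1965ArithmeticVIII] [cite: SilvermanAEC2009, App. C §11, Example 11.3.1–11.3.2] -/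
theorem bsdTriple_of_hasCM_of_L_one_ne_zero_of_BurungaleFlach2024_of_j_mem_cmJInvariants_of_hasCM
    (hBF : BurungaleFlach2024_bsd_rat) (h₁ : j_mem_cmJInvariants_of_hasCM)
    (hISO : bsdRHS_eq_of_isIsogenous) : bsdTriple_of_hasCM_of_L_one_ne_zero := by
  intro W _ _ hCM hL
  obtain ⟨W', hE', hmin', hiso, hj', hLS⟩ :=
    exists_isGloballyMinimal_isIsogenous_LSeries_eq_of_hasCM h₁ W hCM
  have hL' : W'.entireLFunction 1 ≠ 0 := by
    rwa [← entireLFunction_eq_of_LSeries_eq hLS]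
  obtain ⟨hfin', -, -⟩ := hBF W' hj' hL'
  exact bsdTriple_of_isIsogenous_of_finite_point_of_LSeries_eq hISO hiso hLS hfin'
    (bsdTriple_of_j_mem_maximalCMJInvariants_of_L_one_ne_zero_of_BurungaleFlach2024 hBF W' hj' hL')

/-- **bsd.S28 (geometric-CM form), level 2, sharpest leaf set**: Corollary 1 over the CM field
(`h₁'`), the Weil-restriction descent `K → ℚ` (`h₂`), `j_mem_cmJInvariants_of_hasCM` (`h₁`) and
Cassels' quotient invariance (`hISO`) — the hypotheses of
`bsdTriple_of_j_mem_maximalCMJInvariants_of_L_one_ne_zero_of_level2` plus `h₁` and `hISO`.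
[cite: BurungaleFlach2024, Thm 1.1, Cor. 1, Cor. 2 (arXiv pp. 3–4)] -/
theorem bsdTriple_of_hasCM_of_L_one_ne_zero_of_level2_of_j_mem_cmJInvariants_of_hasCM
    (h₁' : BurungaleFlach2024_bsd_cmField) (h₂ : BurungaleFlach2024_bsd_rat_of_bsd_cmField)
    (h₁ : j_mem_cmJInvariants_of_hasCM) (hISO : bsdRHS_eq_of_isIsogenous) :
    bsdTriple_of_hasCM_of_L_one_ne_zero :=
  bsdTriple_of_hasCM_of_L_one_ne_zero_of_BurungaleFlach2024_of_j_mem_cmJInvariants_of_hasCM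
    (BurungaleFlach2024_bsd_rat_of_level2 h₁' h₂) h₁ hISO

end Literature.NumberTheory.EllipticCurves

end
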